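import Summits.AnomalousDissipation.AnomalousDissipation.Theorems.SolenoidalFractalHomogenisationPermissibleFractalCarrierRegular
import Summits.AnomalousDissipation.AnomalousDissipation.Theorems.SolenoidalFractalHomogenisationPermissibleFractalCarrierBookkeeping

/-!
# The crux `PermissibleFractalCarrier` (K3) of route `SolenoidalFractalHomogenisation` — closed
(stmt-AnomalousDissipation-19073; support seat ad-sawtooth-support g7, cell ad-ideate)

The planner's kernel-checked composition `PermissibleFractalCarrier_of_stubs` (BC3 birth skeleton
`Cruxes.PermissibleFractalCarrier.Birth`) over the two registered stubs, both landed: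
`stub_bookkeeping` (p508967, the arithmetic window) and `stub_regular` (the analytic half).
-/

set_option linter.dupNamespace false

namespace Summit.AnomalousDissipation.AnomalousDissipation.Theorems

open Summit.AnomalousDissipation.AnomalousDissipation.Theorems.SolenoidalFractalHomogenisation.PermissibleCarrier

/-- **Crux K3 `PermissibleFractalCarrier`**: for every word design `W`, constants `c, ν₀, K > 0` and every
prescribed minimal scale separation `Λ₀` there is a fractal shear carrier replaying `W` which is `Permissible`
and `Regular` with `Λ₀ N_m ≤ N_{m+1}` — by `stub_bookkeeping` (explicit window with `a_m = r^m ≤ N_m^{7/8}`) and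
`stub_regular` (permissible + amplitude law ⇒ regular). [cite: ArmstrongVicol2025, §3 (fractal alternating-shear carrier)] -/
theorem permissibleFractalCarrier_proof :
    Summit.AnomalousDissipation.AnomalousDissipation.Theses.SolenoidalFractalHomogenisation.PermissibleFractalCarrier := by
  intro k W c ν₀ K Λ₀ hc hν₀ hK
  obtain ⟨D, h1, h2, h3, h4, hP, hamp, hsep⟩ := stub_bookkeeping k W c ν₀ K Λ₀ hc hν₀ hK
  exact ⟨D, h1, h2, h3, h4, hP, stub_regular k D hP hamp, hsep⟩

end Summit.AnomalousDissipation.AnomalousDissipation.Theorems
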